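import Summits.KontsevichZagierPeriods.KontsevichZagierPeriods.Theses.SymplecticScissors

/-!
# Sketch — crux-ideate round 1, ideator 3, crux `PlanarCompiler` (stmt-KontsevichZagierPeriods-10058)

First-lemma signatures for the three idea cards (they must elaborate; they are not proved here):

* card `multiplicity-calculus`      : `planarGroup`, `IndicatorLemmaP`, `DipoleMem`, `MultFun`, `Dipole`,
                                      `MultiplicityForm`, `MultiplicityCompiler`, `TransferA`
* card `two-cad-sweep`              : `SweepCellImage` (PROVED below: `sweepCellImage_holds`)
* card `smooth-locus-excision`      : `NullInvisible`, `GenericAdmissible`, `GenericGraphScaling`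
-/

noncomputable section

open MeasureTheory Set
open Literature.NumberTheory.Transcendental
open Literature.ModelTheory.ExponentialFields (IsSemialgebraic)

namespace Summit.KontsevichZagierPeriods.KontsevichZagierPeriods.Cruxes.PlanarCompiler.Ideator3

open Summit.KontsevichZagierPeriods.KontsevichZagierPeriods.Theses.SymplecticScissors

/-- The planar set-chain group `P` of the route (target of `PlanarK0Injective`). -/
def planarGroup : AddSubgroup KZ.FormalRep :=
  AddSubgroup.closure ((KZ.domainAddRel ∪ KZ.changeOfVariablesRel) ∩
    (AddSubgroup.closure {x : KZ.FormalRep | ∃ s : KZ.IntegralRep 2,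
      (∀ p ∈ s.domain, s.integrand p = 1) ∧ x = KZ.of s} : Set KZ.FormalRep))

/-- Sanity: `PlanarK0Injective` is membership in `planarGroup`. -/
example : PlanarK0Injective ↔
    ∀ (r r' : KZ.IntegralRep 2), (∀ p ∈ r.domain, r.integrand p = 1) →
      (∀ p ∈ r'.domain, r'.integrand p = 1) → r.value = r'.value →
      KZ.of r - KZ.of r' ∈ planarGroup := Iff.rfl

/-! ## Card A — multiplicity calculus -/

/-- **Indicator lemma for `P`** (card A, first lemma): a `ℤ`-combination of planar integrand-1
representations whose weighted indicator vanishes a.e. lies in `P` (indeed in the closure of the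
planar (1a)-instances): atoms of the finite Boolean algebra generated by the domains; each `[sᵢ]` is
the exact disjoint sum of its atoms by iterated (1a); the coefficient collected on a non-null atom is the
a.e. value of the weighted indicator there, hence `0`; null atoms `N` satisfy `−[N] ∈ domainAddRel`
(`N = N ∪ N`). No cylindrical decomposition is needed. -/
def IndicatorLemmaP : Prop :=
  ∀ (k : ℕ) (s : Fin k → KZ.IntegralRep 2) (c : Fin k → ℤ),
    (∀ i, ∀ p ∈ (s i).domain, (s i).integrand p = 1) →
    (∀ᵐ p ∂(volume : Measure (Fin 2 → ℝ)),
        ∑ i, (c i : ℝ) * (s i).domain.indicator (fun _ => (1 : ℝ)) p = 0) →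
    ∑ i, c i • KZ.of (s i) ∈ planarGroup

/-- **Dipoles are in `P`** (card A, trivial companion): one admissible `|det| = 1` map between two
planar integrand-1 sets gives a generator of `P`. -/
def DipoleMem : Prop :=
  ∀ (U : Set (Fin 2 → ℝ)) (Φ : (Fin 2 → ℝ) → (Fin 2 → ℝ))
    (Φ' : (Fin 2 → ℝ) → (Fin 2 → ℝ) →L[ℝ] (Fin 2 → ℝ)) (r r' : KZ.IntegralRep 2),
    IsSemialgebraicMapOn ℚ U Φ → (∀ x ∈ U, HasFDerivWithinAt Φ (Φ' x) U x) → InjOn Φ U →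
    (∀ x ∈ U, |(Φ' x).det| = 1) → r.domain = U → r'.domain = Φ '' U →
    (∀ p ∈ r.domain, r.integrand p = 1) → (∀ p ∈ r'.domain, r'.integrand p = 1) →
    KZ.of r - KZ.of r' ∈ planarGroup

/-- Integer multiplicity functions `𝓜`: finitely many values, `ℚ`-semialgebraic level sets,
integrable (finite-area support). `ℤ[planar int-1]/⟨planar 1a⟩ ≅ 𝓜/(a.e.)` via `r ↦ 1_{r.domain}`. -/
structure MultFun where
  /-- the multiplicity function -/
  toFun : (Fin 2 → ℝ) → ℤ
  finite_range : (Set.range toFun).Finite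
  isSemialgebraic_fiber : ∀ n : ℤ, IsSemialgebraic ℚ (toFun ⁻¹' {n})
  integrable : Integrable (fun p => (toFun p : ℝ))

/-- A transport dipole datum: an admissible map (rule (2) hypotheses, `|det| = 1`) on a finite-area
`ℚ`-semialgebraic set. Its function is `1_U − 1_{Φ U}`. -/
structure Dipole where
  /-- source set -/
  U : Set (Fin 2 → ℝ)
  /-- the map -/
  Φ : (Fin 2 → ℝ) → (Fin 2 → ℝ)
  /-- its derivative within `U` -/
  Φ' : (Fin 2 → ℝ) → (Fin 2 → ℝ) →L[ℝ] (Fin 2 → ℝ)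
  isSemialgebraic_U : IsSemialgebraic ℚ U
  volume_lt_top : volume U < ⊤
  semialg : IsSemialgebraicMapOn ℚ U Φ
  hasDeriv : ∀ x ∈ U, HasFDerivWithinAt Φ (Φ' x) U x
  inj : InjOn Φ U
  det_eq : ∀ x ∈ U, |(Φ' x).det| = 1

/-- The dipole function `1_U − 1_{Φ U}`. -/
def Dipole.fn (d : Dipole) (p : Fin 2 → ℝ) : ℝ :=
  d.U.indicator (fun _ => (1 : ℝ)) p - (d.Φ '' d.U).indicator (fun _ => (1 : ℝ)) p

/-- **Multiplicity form of planar `K₀`-injectivity** (card A, the transfer target's conclusion):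
every mean-zero integer multiplicity function is, a.e., a `ℤ`-combination of transport dipoles.
`PlanarK0Injective ↔ MultiplicityForm` modulo `IndicatorLemmaP` + `DipoleMem` + Tarski–Seidenberg. -/
def MultiplicityForm : Prop :=
  ∀ m : MultFun, ∫ p, (m.toFun p : ℝ) = 0 →
    ∃ (k : ℕ) (d : Fin k → Dipole) (ε : Fin k → ℤ),
      ∀ᵐ p ∂(volume : Measure (Fin 2 → ℝ)), (m.toFun p : ℝ) = ∑ j, (ε j : ℝ) * (d j).fn p

/-- **Transfer `C⁺`** (card A): the compiler in multiplicity clothes. -/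
def MultiplicityCompiler : Prop := RealOnePeriodRelations → MultiplicityForm

/-- `C⁺ → crux`, given the indicator lemma and the dipole lemma (card A, glue claim). -/
def TransferA : Prop := IndicatorLemmaP → DipoleMem → MultiplicityCompiler → PlanarCompiler

/-! ## Card B — two one-directional cell decompositions for the Green step -/

/-- **Sweep image of a vertical cell** (card B, first lemma): on a vertical cell over `(α, β)` on
whose closed fibres `b ↦ A(a,b)` is continuous and strictly increasing, the sweep `Ψ_A = (a, A(a,b))`
maps the cell EXACTLY onto the region strictly between the two traces `a ↦ A(a, b₀ a)` and
`a ↦ A(a, b₁ a)` (IVT + strict monotonicity, fibrewise). Summing over the consecutive cells of ONE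
vertical decomposition telescopes to the region between bottom and top trace (cocycle); the second
coefficient is treated with an independent horizontal decomposition, and the engine
(`EqualJacobianTransport`) runs on pairwise intersections of cells, where injectivity is inherited. -/
def SweepCellImage : Prop :=
  ∀ (α β : ℝ) (b₀ b₁ : ℝ → ℝ) (A : (Fin 2 → ℝ) → ℝ), α < β →
    (∀ a ∈ Ioo α β, b₀ a < b₁ a) →
    (∀ a ∈ Ioo α β, ContinuousOn (fun b : ℝ => A ![a, b]) (Icc (b₀ a) (b₁ a))) →
    (∀ a ∈ Ioo α β, StrictMonoOn (fun b : ℝ => A ![a, b]) (Icc (b₀ a) (b₁ a))) →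
    (fun p : Fin 2 → ℝ => ![p 0, A p]) '' {p | p 0 ∈ Ioo α β ∧ b₀ (p 0) < p 1 ∧ p 1 < b₁ (p 0)} =
      {q | q 0 ∈ Ioo α β ∧ A ![q 0, b₀ (q 0)] < q 1 ∧ q 1 < A ![q 0, b₁ (q 0)]}


/-! ## Proof of card B's first lemma (ideation-stage bonus; kernel-checked) -/

private lemma fin2_eta (p : Fin 2 → ℝ) : ![p 0, p 1] = p := by
  ext i; fin_cases i <;> rfl

/-- `SweepCellImage` holds: IVT on the closed fibre + strict monotonicity. -/
theorem sweepCellImage_holds : SweepCellImage := by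
  intro α β b₀ b₁ A _hαβ hlt hcont hmono
  ext q
  simp only [mem_image, mem_setOf_eq]
  constructor
  · rintro ⟨p, ⟨hp0, hp1, hp2⟩, rfl⟩
    simp only [Matrix.cons_val_zero, Matrix.cons_val_one]
    have hm := hmono (p 0) hp0
    have hb0 : b₀ (p 0) ∈ Icc (b₀ (p 0)) (b₁ (p 0)) := ⟨le_rfl, (hlt _ hp0).le⟩
    have hb1 : b₁ (p 0) ∈ Icc (b₀ (p 0)) (b₁ (p 0)) := ⟨(hlt _ hp0).le, le_rfl⟩
    have hpm : p 1 ∈ Icc (b₀ (p 0)) (b₁ (p 0)) := ⟨hp1.le, hp2.le⟩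
    refine ⟨hp0, ?_, ?_⟩
    · have := hm hb0 hpm hp1
      simpa [fin2_eta] using this
    · have := hm hpm hb1 hp2
      simpa [fin2_eta] using this
  · rintro ⟨hq0, hq1, hq2⟩
    have hc := hcont (q 0) hq0
    have hle : b₀ (q 0) ≤ b₁ (q 0) := (hlt _ hq0).le
    have hmem : q 1 ∈ Icc (A ![q 0, b₀ (q 0)]) (A ![q 0, b₁ (q 0)]) := ⟨hq1.le, hq2.le⟩
    obtain ⟨b, hb, hbq⟩ := intermediate_value_Icc hle hc hmem
    have hb0 : b₀ (q 0) < b := by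
      rcases hb.1.lt_or_eq with h | h
      · exact h
      · exfalso; rw [← h] at hbq; simp only at hbq; linarith
    have hb1 : b < b₁ (q 0) := by
      rcases hb.2.lt_or_eq with h | h
      · exact h
      · exfalso; rw [h] at hbq; simp only at hbq; linarith
    refine ⟨![q 0, b], ⟨?_, ?_, ?_⟩, ?_⟩
    · simpa using hq0
    · simpa using hb0
    · simpa using hb1
    · ext i; fin_cases i
      · simp
      · simp only [Matrix.head_cons]
        simpa using hbq

/-! ## Card C — smooth-locus excision -/

/-- **Null sets are invisible in `P`** (card C, first half; = the bookkeeping of `TransportToGroup`):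
removing a null `ℚ`-semialgebraic subset from a planar integrand-1 set does not change its class. -/
def NullInvisible : Prop :=
  ∀ (r s : KZ.IntegralRep 2), (∀ p ∈ r.domain, r.integrand p = 1) →
    (∀ p ∈ s.domain, s.integrand p = 1) → s.domain ⊆ r.domain →
    volume (r.domain \ s.domain) = 0 → KZ.of r - KZ.of s ∈ planarGroup

/-- **Generic admissibility** (card C, first lemma): a `ℚ`-semialgebraic map on an open
`ℚ`-semialgebraic planar set is `C¹` off a closed-in-`U`, null, `ℚ`-semialgebraic subset — so every
rule-(2) side condition ("differentiable at EVERY point of the domain") is met after excising a set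
that `NullInvisible` absorbs. From `IsSemialgebraicFunOn.exists_contDiffOn_holds` (coordinatewise)
and "empty interior ⇒ null" for planar semialgebraic sets (cylindrical decomposition). -/
def GenericAdmissible : Prop :=
  ∀ (U : Set (Fin 2 → ℝ)) (Φ : (Fin 2 → ℝ) → (Fin 2 → ℝ)), IsOpen U → IsSemialgebraic ℚ U →
    IsSemialgebraicMapOn ℚ U Φ →
    ∃ Z : Set (Fin 2 → ℝ), Z ⊆ U ∧ IsSemialgebraic ℚ Z ∧ volume Z = 0 ∧ IsOpen (U \ Z) ∧
      ContDiffOn ℝ 1 Φ (U \ Z)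

/-- **Generic graph-scaling data in dimension one** (card C, companion): an injective continuous
`ℚ`-semialgebraic `Φ` on an interval is `C²` with `Φ′ ≠ 0` off a finite set — the input the shear
`(x, y) ↦ (Φ x, y / |Φ′ x|)` (`FiniteMapShear`) needs on each remaining open piece. -/
def GenericGraphScaling : Prop :=
  ∀ (a b : ℝ) (Φ : ℝ → ℝ), a < b →
    IsSemialgebraicFunOn ℚ {z : Fin 1 → ℝ | z 0 ∈ Ioo a b} (fun z => Φ (z 0)) →
    InjOn Φ (Ioo a b) → ContinuousOn Φ (Ioo a b) →
    ∃ F : Finset ℝ, ∀ x ∈ Ioo a b, x ∉ F → ContDiffAt ℝ 2 Φ x ∧ deriv Φ x ≠ 0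

end Summit.KontsevichZagierPeriods.KontsevichZagierPeriods.Cruxes.PlanarCompiler.Ideator3
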